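import Literature.AnabelianGeometry.EtaleTheta.GalSectThm110iiiTransport
import Literature.AnabelianGeometry.EtaleTheta.GalSectSplittingsTorsorCanonical
import Literature.AnabelianGeometry.EtaleTheta.Discharge.Sec1Thm110MatchingOfDeck
import HarnessLib

/-!
# [EtTh] Thm. 1.10 (iii) — END-KNIT AT THE GENUINE `H¹`-TORSOR: the typed statement with the transport
# data `(e, he)`, `φ`, `hequiv` as THEOREMS; residual = named inputs only (proof-only)

Mochizuki, *The étale theta function …* [EtTh], Publ. RIMS **45** (2009), Thm. 1.10 (iii) p.256
[cite: MochizukiEtTh2009, Thm 1.10 (iii) p.30]; [GalSect] §4 / Def. 4.1 [cite: MochizukiGalSect2005, §4 p.33].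
abc-iut cell, layer L2, row «Thm 1.10 (iii) / Cor 2.8 (ii) END-KNIT at the genuine H¹-torsor» (abc-iut-L2-lead
gen 3, R210, GO 09:22:43Z; seat abc-iut-w5-d062 gen 3).  PROOF-ONLY: no definitions, no named facts, nothing of
the K2 files (abc-iut-w5-d140) or of O1 restated — both consumed BY NAME.

## What is proved

* `thm110iiiGalSect_of_genuineTorsor` — the typed `Thm110iiiGalSect H Sα Sβ Cα Cβ` (ROW (C)) from NAMED inputs:
  (law) the canonical integral structure at the cusp of `Ċα` is an `O_K^×`-structure ([GalSect] Def. 4.1 (iii);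
  v-next field `DotCCusp.canonical_isStructure`, G-w5d062-2);
  (b1) the extension `Γ` of `γ`, corrected by `Inn c`, carries the cuspidal pair of `Ċα` onto that of `Ċβ`
  ([SemiAnbd] Thm. 6.8 (iii) genre — sub-DAG row T110.ii.r3);
  (gen) **the cusp data's `(K^×)^∧`-torsors ARE the genuine torsors of [GalSect] §4** — through SOME isomorphism
  `κ : (K^×)^∧ ≃ Ker(res) ⊆ H¹(D, I)` the abstract action `DotCCusp.torsor` is abc-iut-w5-d029's cohomological
  `CuspPair.torsorDataH1` ("the splittings form a torsor over `H¹(G_K, Ẑ(1)) ≅ (K^×)^∧`": Kummer theory, the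
  content of the origin predicate) — with the topological side conditions this needs (`D` closed, `I` compact
  abelian, `Π^tp_C` T1);
  (μ) the isomorphism `δ : (K_α^×)^∧ ≃ (K_β^×)^∧` along which the class transport is equivariant (it EXISTS and
  is unique — see below) carries `μ₂(K_α)` to `μ₂(K_β)` (print: `δ` is induced by the field isomorphism of
  Thm. 1.10 (ii), `±1 ↦ ±1`);
  (b3) the class transport carries the canonical integral structure of `Ċα` into that of `Ċβ` ([GalSect]
  Def. 4.1 (iv) / Cor. 4.12: functoriality of canonical integral structures).
  INSIDE the proof, and no longer binders: the class transport `(e, he)` (`exists_classTransport`, p433009), an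
  isomorphism `φ` of the genuine structure groups with `e (k • c) = φ(k) • e(c)` (`exists_torsorDataH1_equivariant`,
  p433561; base change `torsorDataH1_base_indep`, p434790), hence O1's `hequiv` for the `(K^×)^∧`-torsors with
  `δ := κβ⁻¹ ∘ φ ∘ κα`, then O1's `thm110iiiGalSect_of_transport` (p427234).
* `thm110_i_ii_iii_of_namedInputs` — the sub-DAG node closer: `Thm110i ∧ Thm110ii ∧ Thm110iiiGalSect` at
  anchored standard data from the UNION of abc-iut-w5-d140's K2 inputs for (i)/(ii)
  (`thm110i_of_decompTransport_of_deck` / `thm110ii_of_decompTransport_of_deck`: `Prop15ii`, `δ̈` with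
  `Thm110DeltaInduced` / `Thm110DeltaCompat`, the typed row r5 `Thm110DecompTransport`, the deck relations) and
  the inputs of (iii) above.

HONEST FRAMING: the named inputs are exactly the printed inferences / cited results; none is asserted; typed ≠
proved; no side taken on [IUTchIII] Cor. 3.12, on which nothing here bears.
-/

namespace Literature.AnabelianGeometry.EtaleTheta

open scoped Pointwise

open Literature.AnabelianGeometry.SemiGraphs

section EndKnit

variable {p : ℕ} [Fact p.Prime] {Mα Mβ : MuTwoSetting p} {εα : Mα.GtpC} {εβ : Mβ.GtpC}
  {hCα : Mα.toThetaSetting.Compat} {hCβ : Mβ.toThetaSetting.Compat}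
  {Eα : Mα.toThetaSetting.EtaleThetaData} {Eβ : Mβ.toThetaSetting.EtaleThetaData}
  {γ : Mα.dotC εα ≃ₜ* Mβ.dotC εβ}

/-- **[EtTh] Thm. 1.10 (iii) (typed, ROW (C)) AT THE GENUINE `H¹`-TORSOR** — residual = named inputs only
(law, (b1), the Kummer identification of the two cusp torsors with the genuine ones, (μ), (b3)); the class
transport, the isomorphism of structure groups and its equivariance are THEOREMS used inside.
[cite: MochizukiEtTh2009, Thm 1.10 (iii) p.30] -/
theorem thm110iiiGalSect_of_genuineTorsor [T1Space Mα.GtpC] [T1Space Mβ.GtpC]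
    (H : Thm110Hypothesis εα εβ hCα hCβ Eα Eβ γ)
    (Sα : Mα.StandardData Eα.toKummerData) (Sβ : Mβ.StandardData Eβ.toKummerData)
    (Cα : Mα.DotCCusp εα) (Cβ : Mβ.DotCCusp εβ)
    [IsMulCommutative Cα.pair.I] [IsMulCommutative Cβ.pair.I]
    (hDα : IsClosed (Cα.pair.D : Set Mα.GtpC)) (hIα : IsCompact (Cα.pair.I : Set Mα.GtpC))
    (hDβ : IsClosed (Cβ.pair.D : Set Mβ.GtpC)) (hIβ : IsCompact (Cβ.pair.I : Set Mβ.GtpC))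
    -- (law) [GalSect] Def. 4.1 (iii)
    (hcan : Cα.torsor.IsStructure (GalSect.unitsHat Mα.toThetaSetting.toTemperedCurve) Cα.canonical)
    -- (b1) cusp-pair transport
    {c : Mβ.GtpC} (hc : c ∈ Mβ.dotC εβ)
    (hpair : Cα.pair.map (H.Γ.trans (Mβ.innerAutC c)) = Cβ.pair)
    -- (gen) the cusp torsors ARE the genuine `H¹`-torsors (base splittings `S₀α`, `S₀β`; any will do)
    {S₀α : Subgroup Mα.GtpC} (hS₀α : S₀α ∈ Cα.pair.splittings)
    {S₀β : Subgroup Mβ.GtpC} (hS₀β : S₀β ∈ Cβ.pair.splittings)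
    (hgenα : haveI := Cα.pair.ID_normal
      ∃ κ : GalSect.KxHat Mα.toThetaSetting.toTemperedCurve ≃*
          ↥(ContH1.resKer Cα.pair.ID (⊤ : Subgroup Cα.pair.D)
            (Cα.pair.isClosedComplement_of_mem_splittings hS₀α).le_left),
        ∀ k cl, Cα.torsor.act k cl = (Cα.pair.torsorDataH1 hDα hIα hS₀α).act (κ k) cl)
    (hgenβ : haveI := Cβ.pair.ID_normal
      ∃ κ : GalSect.KxHat Mβ.toThetaSetting.toTemperedCurve ≃*
          ↥(ContH1.resKer Cβ.pair.ID (⊤ : Subgroup Cβ.pair.D)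
            (Cβ.pair.isClosedComplement_of_mem_splittings hS₀β).le_left),
        ∀ k cl, Cβ.torsor.act k cl = (Cβ.pair.torsorDataH1 hDβ hIβ hS₀β).act (κ k) cl)
    -- (μ) the induced `δ` carries `μ₂` to `μ₂`
    (hμ : ∀ (δ : GalSect.KxHat Mα.toThetaSetting.toTemperedCurve →* GalSect.KxHat Mβ.toThetaSetting.toTemperedCurve)
        (e : Cα.pair.SplittingClass → Cβ.pair.SplittingClass),
      (∀ (S : Subgroup Mα.GtpC) (hS : S ∈ Cα.pair.splittings),
        ∃ h', e (GalSect.CuspPair.SplittingClass.mk Cα.pair S hS) =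
          GalSect.CuspPair.SplittingClass.mk Cβ.pair
            (S.map (H.Γ.trans (Mβ.innerAutC c)).toMulEquiv.toMonoidHom) h') →
      (∀ (k : GalSect.KxHat Mα.toThetaSetting.toTemperedCurve) (cl : Cα.pair.SplittingClass),
        e (Cα.torsor.act k cl) = Cβ.torsor.act (δ k) (e cl)) →
      Mα.muTwoHat.map δ = Mβ.muTwoHat)
    -- (b3) canonical integral structures correspond under THE class transport
    (hecan : ∀ (e : Cα.pair.SplittingClass → Cβ.pair.SplittingClass),
      (∀ (S : Subgroup Mα.GtpC) (hS : S ∈ Cα.pair.splittings),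
        ∃ h', e (GalSect.CuspPair.SplittingClass.mk Cα.pair S hS) =
          GalSect.CuspPair.SplittingClass.mk Cβ.pair
            (S.map (H.Γ.trans (Mβ.innerAutC c)).toMulEquiv.toMonoidHom) h') →
      e '' Cα.canonical ⊆ Cβ.canonical) :
    Thm110iiiGalSect H Sα Sβ Cα Cβ := by
  haveI := Cα.pair.ID_normal
  haveI := Cβ.pair.ID_normal
  obtain ⟨κα, hκα⟩ := hgenα
  obtain ⟨κβ, hκβ⟩ := hgenβ
  -- the class transport along `Γ' := Γ ∘ Inn c` (THEOREM, p433009)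
  obtain ⟨e, he⟩ := GalSect.CuspPair.exists_classTransport (H.Γ.trans (Mβ.innerAutC c)) hpair
  -- the transported base splitting on the β side
  have hS₀β' : S₀α.map (H.Γ.trans (Mβ.innerAutC c)).toMulEquiv.toMonoidHom ∈ Cβ.pair.splittings := by
    rw [← hpair]; exact Cα.pair.map_mem_splittings _ hS₀α
  -- equivariance at the genuine torsors (THEOREM, p433561), bases `S₀α ↦ Γ' S₀α`
  obtain ⟨φ, hφ⟩ :=
    GalSect.CuspPair.exists_torsorDataH1_equivariant hpair hDα hIα hDβ hIβ hS₀α hS₀β' he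
  -- the genuine torsor does not depend on the base (THEOREM, p434790)
  have hbase : Cβ.pair.torsorDataH1 hDβ hIβ hS₀β' = Cβ.pair.torsorDataH1 hDβ hIβ hS₀β :=
    Cβ.pair.torsorDataH1_base_indep hDβ hIβ hS₀β' hS₀β
  -- the induced homomorphism of the ABSTRACT structure groups and its equivariance
  let δ : GalSect.KxHat Mα.toThetaSetting.toTemperedCurve →* GalSect.KxHat Mβ.toThetaSetting.toTemperedCurve :=
    κβ.symm.toMonoidHom.comp (φ.toMonoidHom.comp κα.toMonoidHom)
  have hequiv : ∀ (k : GalSect.KxHat Mα.toThetaSetting.toTemperedCurve) (cl : Cα.pair.SplittingClass),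
      e (Cα.torsor.act k cl) = Cβ.torsor.act (δ k) (e cl) := by
    intro k cl
    have h1 : δ k = κβ.symm (φ (κα k)) := rfl
    rw [hκα, hφ, hbase, h1, hκβ, MulEquiv.apply_symm_apply]
  exact thm110iiiGalSect_of_transport H Sα Sβ Cα Cβ hcan hc hpair δ (hμ δ e he hequiv) e he hequiv
    (hecan e he)

/-- **The sub-DAG node closer — [EtTh] Thm. 1.10 (i) ∧ (ii) ∧ (iii) from NAMED inputs only** (at anchored
standard data): (i)/(ii) by abc-iut-w5-d140's `thm110i_of_decompTransport_of_deck` /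
`thm110ii_of_decompTransport_of_deck` from {`Prop15ii` on both sides, the isomorphism `δ̈ : K̈α^× ≃ K̈β^×` with
`Thm110DeltaInduced` (Thm. 1.6 (ii)) and `Thm110DeltaCompat` ([AbsAnab] Prop. 1.2.1), the typed row r5
`Thm110DecompTransport`, the two deck relations}; (iii) by `thm110iiiGalSect_of_genuineTorsor` from {law, (b1),
(gen), (μ), (b3)}.  [cite: MochizukiEtTh2009, Thm 1.10 p.30] -/
theorem thm110_i_ii_iii_of_namedInputs [T1Space Mα.GtpC] [T1Space Mβ.GtpC]
    (H : Thm110Hypothesis εα εβ hCα hCβ Eα Eβ γ)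
    (Aα : Mα.AnchoredStandardData Eα.toKummerData) (Aβ : Mβ.AnchoredStandardData Eβ.toKummerData)
    -- inputs of (i)/(ii) (K2)
    (h15iiα : ThetaSetting.Prop15ii Eα.toKummerData hCα)
    (h15iiβ : ThetaSetting.Prop15ii Eβ.toKummerData hCβ)
    (δdd : (↥Mα.Kdd)ˣ ≃* (↥Mβ.Kdd)ˣ) (hδdd : Thm110DeltaInduced H δdd)
    (hcompat : Thm110DeltaCompat (Mα := Mα) (Mβ := Mβ) δdd)
    (hτ : Thm110DecompTransport H Aα.toStandardData Aβ.toStandardData)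
    {eα : Mα.PiTemp} (heα : Mα.toZ eα = 1)
    (hDτα : Aα.tauInv.Dpt = Aα.tau.Dpt.comap (MulAut.conj eα).toMonoidHom)
    {eβ : Mβ.PiTemp} (heβ : Mβ.toZ eβ = 1)
    (hDτβ : Aβ.tauInv.Dpt = Aβ.tau.Dpt.comap (MulAut.conj eβ).toMonoidHom)
    -- inputs of (iii)
    (Cα : Mα.DotCCusp εα) (Cβ : Mβ.DotCCusp εβ)
    [IsMulCommutative Cα.pair.I] [IsMulCommutative Cβ.pair.I]
    (hDα : IsClosed (Cα.pair.D : Set Mα.GtpC)) (hIα : IsCompact (Cα.pair.I : Set Mα.GtpC))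
    (hDβ : IsClosed (Cβ.pair.D : Set Mβ.GtpC)) (hIβ : IsCompact (Cβ.pair.I : Set Mβ.GtpC))
    (hcan : Cα.torsor.IsStructure (GalSect.unitsHat Mα.toThetaSetting.toTemperedCurve) Cα.canonical)
    {c : Mβ.GtpC} (hc : c ∈ Mβ.dotC εβ)
    (hpair : Cα.pair.map (H.Γ.trans (Mβ.innerAutC c)) = Cβ.pair)
    {S₀α : Subgroup Mα.GtpC} (hS₀α : S₀α ∈ Cα.pair.splittings)
    {S₀β : Subgroup Mβ.GtpC} (hS₀β : S₀β ∈ Cβ.pair.splittings)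
    (hgenα : haveI := Cα.pair.ID_normal
      ∃ κ : GalSect.KxHat Mα.toThetaSetting.toTemperedCurve ≃*
          ↥(ContH1.resKer Cα.pair.ID (⊤ : Subgroup Cα.pair.D)
            (Cα.pair.isClosedComplement_of_mem_splittings hS₀α).le_left),
        ∀ k cl, Cα.torsor.act k cl = (Cα.pair.torsorDataH1 hDα hIα hS₀α).act (κ k) cl)
    (hgenβ : haveI := Cβ.pair.ID_normal
      ∃ κ : GalSect.KxHat Mβ.toThetaSetting.toTemperedCurve ≃*
          ↥(ContH1.resKer Cβ.pair.ID (⊤ : Subgroup Cβ.pair.D)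
            (Cβ.pair.isClosedComplement_of_mem_splittings hS₀β).le_left),
        ∀ k cl, Cβ.torsor.act k cl = (Cβ.pair.torsorDataH1 hDβ hIβ hS₀β).act (κ k) cl)
    (hμ : ∀ (δ : GalSect.KxHat Mα.toThetaSetting.toTemperedCurve →* GalSect.KxHat Mβ.toThetaSetting.toTemperedCurve)
        (e : Cα.pair.SplittingClass → Cβ.pair.SplittingClass),
      (∀ (S : Subgroup Mα.GtpC) (hS : S ∈ Cα.pair.splittings),
        ∃ h', e (GalSect.CuspPair.SplittingClass.mk Cα.pair S hS) =
          GalSect.CuspPair.SplittingClass.mk Cβ.pair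
            (S.map (H.Γ.trans (Mβ.innerAutC c)).toMulEquiv.toMonoidHom) h') →
      (∀ (k : GalSect.KxHat Mα.toThetaSetting.toTemperedCurve) (cl : Cα.pair.SplittingClass),
        e (Cα.torsor.act k cl) = Cβ.torsor.act (δ k) (e cl)) →
      Mα.muTwoHat.map δ = Mβ.muTwoHat)
    (hecan : ∀ (e : Cα.pair.SplittingClass → Cβ.pair.SplittingClass),
      (∀ (S : Subgroup Mα.GtpC) (hS : S ∈ Cα.pair.splittings),
        ∃ h', e (GalSect.CuspPair.SplittingClass.mk Cα.pair S hS) =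
          GalSect.CuspPair.SplittingClass.mk Cβ.pair
            (S.map (H.Γ.trans (Mβ.innerAutC c)).toMulEquiv.toMonoidHom) h') →
      e '' Cα.canonical ⊆ Cβ.canonical) :
    Thm110i H Aα.toStandardData Aβ.toStandardData ∧ Thm110ii H Aα.toStandardData Aβ.toStandardData ∧
      Thm110iiiGalSect H Aα.toStandardData Aβ.toStandardData Cα Cβ :=
  ⟨thm110i_of_decompTransport_of_deck H Aα Aβ h15iiα h15iiβ δdd hδdd hcompat hτ heα hDτα heβ hDτβ,
    thm110ii_of_decompTransport_of_deck H Aα Aβ h15iiα h15iiβ δdd hδdd hτ heα hDτα heβ hDτβ,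
    thm110iiiGalSect_of_genuineTorsor H Aα.toStandardData Aβ.toStandardData Cα Cβ hDα hIα hDβ hIβ hcan hc
      hpair hS₀α hS₀β hgenα hgenβ hμ hecan⟩

end EndKnit

end Literature.AnabelianGeometry.EtaleTheta
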